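import Summits.SmoothPoincare4.SmoothPoincare4.Theorems.SullivanDualTargetHelperKjRadialKit

/-!
# SmoothPoincare4 / SullivanDual — crux `Target` (stmt-SmoothPoincare4-7823), line `kaehler-jacket`:
# the Euclidean collar map of `stub_ballExtension` (registered helper `helper_kjCollarMap`)

Lead c6.  Chart transfer of the collar `Ψ` of `stub_liouvilleCollar` to a EUCLIDEAN collar map
`κ = M_u⁻¹ ∘ Ψ ∘ e_q⁻¹ ∘ (c + μ A ·)` near the unit sphere of `ℝ⁴`, in exactly the format consumed
by `helper_collarFirstOrder` / `helper_collarInterpolation` (smooth with injective differential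
on a shell `|‖y‖ − 1| < δ`, the identity on the unit sphere, inner side ↦ inner side), together
with the identity `M_u ∘ κ ∘ (A⁻¹ (μ⁻¹ (e_q − c))) = Ψ` on the chart source that lets the
assembly recognise `Ψ` in the cap immersion.  Uses the radial-model and chart kits of
`SullivanDualTargetHelperKjRadialKit`.

References: H. Geiges, *An Introduction to Contact Topology* (2008), Lemma 5.2.4 and Lemma 1.7.2
(collars of star-shaped hypersurfaces).
-/

noncomputable section

set_option linter.dupNamespace false

open scoped Manifold ContDiff Topology
open Set Function Filter Metric
open Literature.Geometry.Kaehler (MForm IsSmoothForm IsClosedForm mextDeriv)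
open Literature.Geometry.Symplectic (punctured InPuncturedChartBall stdSymplecticForm inversion
  invertedStdForm IsSymplecticStandardNearPoint AgreesWithInvertedChartNear)
open Literature.Topology.FourManifolds (HomotopySphere)

namespace Summit.SmoothPoincare4.SmoothPoincare4.Theorems.Target.KaehlerJacket

local notation "E4" => EuclideanSpace ℝ (Fin 4)

/-! ## §3 The Euclidean collar map -/

section CollarMap

variable {S : HomotopySphere 4} {p q : S.carrier}

/-- Points `y` with `|‖y‖ - 1| < δ` lie in the `δ`-thickening of the unit sphere (witness
`y/‖y‖`). [folklore] -/
theorem mem_thickening_sphere_of_abs_norm_sub_one_lt {δ : ℝ} {y : E4} (hy : |‖y‖ - 1| < δ)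
    (hδ : δ ≤ 1) : y ∈ Metric.thickening δ (Metric.sphere (0 : E4) 1) := by
  have hy0 : y ≠ 0 := by
    intro h
    rw [h, norm_zero, zero_sub, abs_neg, abs_one] at hy
    exact absurd hδ (not_le.2 hy)
  have hn : ‖y‖ ≠ 0 := norm_ne_zero_iff.2 hy0
  rw [Metric.mem_thickening_iff]
  refine ⟨‖y‖⁻¹ • y, by simp [norm_smul, hn], ?_⟩
  rw [dist_eq_norm]
  have : y - ‖y‖⁻¹ • y = (1 - ‖y‖⁻¹) • y := by rw [sub_smul, one_smul]
  rw [this, norm_smul, Real.norm_eq_abs]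
  have h2 : |1 - ‖y‖⁻¹| * ‖y‖ = |‖y‖ - 1| := by
    rw [← abs_of_pos (norm_pos_iff.2 hy0), ← abs_mul, abs_of_pos (norm_pos_iff.2 hy0)]
    congr 1
    field_simp
  rw [h2]
  exact hy

/-- An open set containing the unit sphere contains a whole shell `{|‖y‖ - 1| < δ}`. [folklore] -/
theorem exists_shell_subset_of_isOpen {V : Set E4} (hV : IsOpen V)
    (hSV : Metric.sphere (0 : E4) 1 ⊆ V) : ∃ δ : ℝ, 0 < δ ∧ δ ≤ 1 ∧ ∀ y : E4, |‖y‖ - 1| < δ → y ∈ V := by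
  obtain ⟨δ, hδ, hsub⟩ := (isCompact_sphere (0 : E4) 1).exists_cthickening_subset_open hV hSV
  refine ⟨min δ 1, lt_min hδ one_pos, min_le_right _ _, fun y hy => hsub ?_⟩
  exact Metric.thickening_subset_cthickening _ _
    (Metric.thickening_mono (min_le_left _ _) _
      (mem_thickening_sphere_of_abs_norm_sub_one_lt hy (min_le_right _ _)))

/-- **The Euclidean collar map of `stub_ballExtension` (registered helper `helper_kjCollarMap`).**
From the collar `Ψ` of `stub_liouvilleCollar` (smooth with injective differential on the chart
shell `|‖e_q x − c‖ − μ| < δ₁` about `q`, equal to the star-shaped model `θ ↦ e^{u(θ)/2} θ` on the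
sphere `‖e_q x − c‖ = μ` through `θ = A⁻¹(μ⁻¹(e_q x − c))`, inner side ↦ inside of the model
hypersurface) we extract a EUCLIDEAN collar map `κ := M_u⁻¹ ∘ Ψ ∘ e_q⁻¹ ∘ (c + μ A ·)` near the
unit sphere: smooth with injective differential on a shell `|‖y‖ − 1| < δ` (`δ` so small that the
shell maps into the chart ball of radius `μ'`, into the `δ₁`-shell, and misses the zeros of `Ψ`),
the IDENTITY on the unit sphere, mapping `‖y‖ < 1` exactly to `‖κ y‖ < 1`, and reproducing `Ψ`:
`M_u (κ (A⁻¹(μ⁻¹(e_q x − c)))) = Ψ x` on the chart source. [folklore] -/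
theorem helper_kjCollarMap :
    ∀ (S : HomotopySphere 4) (p q : S.carrier) (μ μ' : ℝ) (A : E4 ≃ₗᵢ[ℝ] E4) (u : E4 → ℝ)
      (Ψ : punctured p → E4) (δ₁ : ℝ),
      q ≠ p → 0 < μ → μ < μ' →
      Metric.closedBall (extChartAt (𝓡 4) q q) μ' ⊆ (extChartAt (𝓡 4) q).target →
      (∀ y ∈ Metric.closedBall (extChartAt (𝓡 4) q q) μ', (extChartAt (𝓡 4) q).symm y ≠ p) →
      ContDiff ℝ ∞ u → 0 < δ₁ →
      (∀ x : punctured p, x.1 ∈ (chartAt E4 q).source →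
        |‖extChartAt (𝓡 4) q x.1 - extChartAt (𝓡 4) q q‖ - μ| < δ₁ →
        ContMDiffAt (𝓡 4) 𝓘(ℝ, E4) ∞ Ψ x ∧ Injective (mfderiv (𝓡 4) 𝓘(ℝ, E4) Ψ x)) →
      (∀ x : punctured p, x.1 ∈ (chartAt E4 q).source →
        ‖extChartAt (𝓡 4) q x.1 - extChartAt (𝓡 4) q q‖ = μ →
        Ψ x = Real.exp (u (A.symm (μ⁻¹ • (extChartAt (𝓡 4) q x.1 - extChartAt (𝓡 4) q q))) / 2) •
          A.symm (μ⁻¹ • (extChartAt (𝓡 4) q x.1 - extChartAt (𝓡 4) q q))) →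
      (∀ x : punctured p, x.1 ∈ (chartAt E4 q).source →
        |‖extChartAt (𝓡 4) q x.1 - extChartAt (𝓡 4) q q‖ - μ| < δ₁ →
        (‖extChartAt (𝓡 4) q x.1 - extChartAt (𝓡 4) q q‖ < μ ↔
          ‖Ψ x‖ < Real.exp (u (‖Ψ x‖⁻¹ • Ψ x) / 2))) →
      ∃ (κ : E4 → E4) (δ : ℝ), 0 < δ ∧ δ < 1 ∧ μ * δ ≤ δ₁ ∧ μ * (1 + δ) < μ' ∧
        (∀ y : E4, |‖y‖ - 1| < δ → ContDiffAt ℝ ∞ κ y ∧ Injective (fderiv ℝ κ y)) ∧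
        (∀ y : E4, ‖y‖ = 1 → κ y = y) ∧
        (∀ y : E4, |‖y‖ - 1| < δ → (‖y‖ < 1 ↔ ‖κ y‖ < 1)) ∧
        (∀ x : punctured p, x.1 ∈ (chartAt E4 q).source →
          Real.exp (u (‖κ (A.symm (μ⁻¹ • (extChartAt (𝓡 4) q x.1 - extChartAt (𝓡 4) q q)))‖⁻¹ •
              κ (A.symm (μ⁻¹ • (extChartAt (𝓡 4) q x.1 - extChartAt (𝓡 4) q q)))) / 2) •
            κ (A.symm (μ⁻¹ • (extChartAt (𝓡 4) q x.1 - extChartAt (𝓡 4) q q))) = Ψ x) := by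
  intro S p q μ μ' A u Ψ δ₁ hq hμ hμμ' hball havoid hu hδ₁ hΨemb hΨsphere hΨsides
  -- notation
  set e := extChartAt (𝓡 4) q with he
  set c : E4 := e q with hc
  set xq : punctured p := ⟨q, Literature.Geometry.Symplectic.mem_punctured.2 hq⟩ with hxq
  set ch := chartAt E4 xq with hch
  -- the affine normalisation of the chart and the Euclidean representative of `Ψ`
  set aff : E4 → E4 := fun y => c + μ • A y with haff
  set Φt : E4 → E4 := fun y => Ψ (ch.symm (aff y)) with hΦt
  set κ : E4 → E4 := fun y => Real.exp (-(u (‖Φt y‖⁻¹ • Φt y) / 2)) • Φt y with hκ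
  -- the first radius
  set δ₀ : ℝ := min (min (δ₁ / μ) ((μ' - μ) / (2 * μ))) (1 / 2) with hδ₀
  have hδ₀pos : 0 < δ₀ := by
    refine lt_min (lt_min (div_pos hδ₁ hμ) (div_pos (by linarith) (by linarith))) (by norm_num)
  have hδ₀μ : μ * δ₀ ≤ δ₁ := by
    have : δ₀ ≤ δ₁ / μ := (min_le_left _ _).trans (min_le_left _ _)
    calc μ * δ₀ ≤ μ * (δ₁ / μ) := by gcongr
      _ = δ₁ := by field_simp
  have hδ₀μ' : μ * (1 + δ₀) < μ' := by
    have : δ₀ ≤ (μ' - μ) / (2 * μ) := (min_le_left _ _).trans (min_le_right _ _)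
    have h2 : μ * δ₀ ≤ (μ' - μ) / 2 := by
      calc μ * δ₀ ≤ μ * ((μ' - μ) / (2 * μ)) := by gcongr
        _ = (μ' - μ) / 2 := by field_simp
    nlinarith
  have hδ₀half : δ₀ ≤ 1 / 2 := min_le_right _ _
  -- basic facts on the shell `|‖y‖ - 1| < δ₀`
  have haff_sub : ∀ y : E4, aff y - c = μ • A y := fun y => by simp [haff]
  have hnorm_aff : ∀ y : E4, ‖aff y - c‖ = μ * ‖y‖ := fun y => by
    rw [haff_sub, norm_smul, Real.norm_of_nonneg hμ.le, LinearIsometryEquiv.norm_map]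
  have haff_mem : ∀ y : E4, |‖y‖ - 1| < δ₀ → aff y ∈ Metric.closedBall c μ' := fun y hy => by
    rw [Metric.mem_closedBall, dist_eq_norm, hnorm_aff]
    have : ‖y‖ < 1 + δ₀ := by linarith [(abs_lt.1 hy).2]
    nlinarith
  -- chart preimages of shell points
  have hshell : ∀ y : E4, |‖y‖ - 1| < δ₀ →
      aff y ∈ ch.target ∧ (ch.symm (aff y)).1 ∈ (chartAt E4 q).source ∧
        e (ch.symm (aff y)).1 = aff y := fun y hy => by
    obtain ⟨h1, -, h3, h4⟩ := mem_chartAt_punctured_target hq hball havoid (haff_mem y hy)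
    exact ⟨h1, h3, h4⟩
  have habsμ : ∀ y : E4, |μ * ‖y‖ - μ| = μ * |‖y‖ - 1| := fun y => by
    rw [← abs_of_pos hμ, ← abs_mul, abs_of_pos hμ]
    ring_nf
  have hdist : ∀ y : E4, |‖y‖ - 1| < δ₀ → |‖e (ch.symm (aff y)).1 - c‖ - μ| < δ₁ :=
    fun y hy => by
    rw [(hshell y hy).2.2, hnorm_aff, habsμ]
    calc μ * |‖y‖ - 1| < μ * δ₀ := by gcongr
      _ ≤ δ₁ := hδ₀μ
  -- smoothness of the affine normalisation
  have hA : ContDiff ℝ ∞ (fun y : E4 => (A y : E4)) := A.toContinuousLinearEquiv.contDiff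
  have haff_smooth : ContDiff ℝ ∞ aff := contDiff_const.add (hA.const_smul μ)
  have haff_deriv : ∀ y : E4,
      HasFDerivAt aff (μ • (A.toContinuousLinearEquiv : E4 →L[ℝ] E4)) y := fun y => by
    have h1 : HasFDerivAt (fun y : E4 => (A y : E4)) (A.toContinuousLinearEquiv : E4 →L[ℝ] E4) y :=
      A.toContinuousLinearEquiv.hasFDerivAt
    exact (h1.const_smul μ).const_add c
  have hAinj : Injective (μ • (A.toContinuousLinearEquiv : E4 →L[ℝ] E4)) := by
    intro v w hvw
    have h' : μ • A v = μ • A w := by simpa using hvw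
    exact A.injective (smul_right_injective E4 hμ.ne' h')
  -- `Ψ`, the inverse chart and their composite on the shell
  have hΨat : ∀ y : E4, |‖y‖ - 1| < δ₀ →
      ContMDiffAt (𝓡 4) 𝓘(ℝ, E4) ∞ Ψ (ch.symm (aff y)) ∧
        Injective (mfderiv (𝓡 4) 𝓘(ℝ, E4) Ψ (ch.symm (aff y))) :=
    fun y hy => hΨemb _ (hshell y hy).2.1 (hdist y hy)
  have hch_symm : ∀ y : E4, |‖y‖ - 1| < δ₀ →
      ContMDiffAt 𝓘(ℝ, E4) (𝓡 4) ∞ ch.symm (aff y) := fun y hy =>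
    (contMDiffOn_chart_symm (x := xq)).contMDiffAt (ch.open_target.mem_nhds (hshell y hy).1)
  have hΦt_smooth : ∀ y : E4, |‖y‖ - 1| < δ₀ → ContDiffAt ℝ ∞ Φt y := fun y hy =>
    contMDiffAt_iff_contDiffAt.1
      ((hΨat y hy).1.comp y ((hch_symm y hy).comp y haff_smooth.contMDiff.contMDiffAt))
  have hΦt_deriv : ∀ y : E4, |‖y‖ - 1| < δ₀ →
      DifferentiableAt ℝ Φt y ∧ Injective (fderiv ℝ Φt y) := fun y hy => by
    have h1 : HasMFDerivAt 𝓘(ℝ, E4) 𝓘(ℝ, E4) aff y (μ • (A.toContinuousLinearEquiv : E4 →L[ℝ] E4)) :=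
      (haff_deriv y).hasMFDerivAt
    have h2 : HasMFDerivAt 𝓘(ℝ, E4) (𝓡 4) ch.symm (aff y)
        (mfderiv 𝓘(ℝ, E4) (𝓡 4) ch.symm (aff y)) :=
      ((mdifferentiable_chart xq).mdifferentiableAt_symm (hshell y hy).1).hasMFDerivAt
    have h3 : HasMFDerivAt (𝓡 4) 𝓘(ℝ, E4) Ψ (ch.symm (aff y))
        (mfderiv (𝓡 4) 𝓘(ℝ, E4) Ψ (ch.symm (aff y))) :=
      ((hΨat y hy).1.mdifferentiableAt (by simp)).hasMFDerivAt
    have h : HasMFDerivAt 𝓘(ℝ, E4) 𝓘(ℝ, E4) Φt y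
        ((mfderiv (𝓡 4) 𝓘(ℝ, E4) Ψ (ch.symm (aff y))).comp
          ((mfderiv 𝓘(ℝ, E4) (𝓡 4) ch.symm (aff y)).comp
            (μ • (A.toContinuousLinearEquiv : E4 →L[ℝ] E4)))) := h3.comp y (h2.comp y h1)
    have hf := hasMFDerivAt_iff_hasFDerivAt.1 h
    have hsrc : aff y ∈ ch.symm.source := by
      rw [OpenPartialHomeomorph.symm_source]
      exact (hshell y hy).1
    -- an honest `E4 →L[ℝ] E4` (dodging the `TangentSpace` synonym in `rw`)
    obtain ⟨L, hL, hLinj⟩ : ∃ L : E4 →L[ℝ] E4, HasFDerivAt Φt L y ∧ Injective L :=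
      ⟨_, hf, fun v w hvw =>
        hAinj ((mdifferentiable_chart xq).symm.mfderiv_injective hsrc ((hΨat y hy).2 hvw))⟩
    refine ⟨hL.differentiableAt, ?_⟩
    rw [hL.fderiv]
    exact hLinj
  -- the model on the unit sphere
  have hΦt_sphere : ∀ θ : E4, ‖θ‖ = 1 → Φt θ = Real.exp (u θ / 2) • θ := fun θ hθ => by
    have hθs : |‖θ‖ - 1| < δ₀ := by
      rw [hθ, sub_self, abs_zero]
      exact hδ₀pos
    have hx := hshell θ hθs
    have hnorm : ‖e (ch.symm (aff θ)).1 - c‖ = μ := by rw [hx.2.2, hnorm_aff, hθ, mul_one]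
    have h := hΨsphere _ hx.2.1 hnorm
    have hdirθ : A.symm (μ⁻¹ • (e (ch.symm (aff θ)).1 - c)) = θ := by
      rw [hx.2.2, haff_sub, smul_smul, inv_mul_cancel₀ hμ.ne', one_smul, A.symm_apply_apply]
    rw [hdirθ] at h
    exact h
  -- the sides
  have hsides : ∀ y : E4, |‖y‖ - 1| < δ₀ → (‖y‖ < 1 ↔ ‖κ y‖ < 1) := fun y hy => by
    have hx := hshell y hy
    have h := hΨsides _ hx.2.1 (hdist y hy)
    rw [hx.2.2, hnorm_aff] at h
    have h1 : ‖y‖ < 1 ↔ μ * ‖y‖ < μ := by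
      constructor
      · intro hh
        nlinarith
      · intro hh
        nlinarith
    rw [h1, h]
    exact (norm_radMinv_lt_one_iff u (Φt y)).symm
  -- a thinner shell on which `Φt` does not vanish
  have hopen₀ : IsOpen {y : E4 | |‖y‖ - 1| < δ₀} :=
    isOpen_lt (continuous_abs.comp (continuous_norm.sub continuous_const)) continuous_const
  have hcont : ContinuousOn Φt {y : E4 | |‖y‖ - 1| < δ₀} := fun y hy =>
    (hΦt_smooth y hy).continuousAt.continuousWithinAt
  have hVopen : IsOpen ({y : E4 | |‖y‖ - 1| < δ₀} ∩ Φt ⁻¹' {0}ᶜ) :=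
    hcont.isOpen_inter_preimage hopen₀ isOpen_compl_singleton
  have hSV : Metric.sphere (0 : E4) 1 ⊆ {y : E4 | |‖y‖ - 1| < δ₀} ∩ Φt ⁻¹' {0}ᶜ := by
    intro θ hθ
    have hθ1 : ‖θ‖ = 1 := by simpa using hθ
    refine ⟨?_, ?_⟩
    · show |‖θ‖ - 1| < δ₀
      rw [hθ1, sub_self, abs_zero]
      exact hδ₀pos
    · show Φt θ ∈ ({0}ᶜ : Set E4)
      rw [Set.mem_compl_singleton_iff, hΦt_sphere θ hθ1]
      refine smul_ne_zero (Real.exp_pos _).ne' ?_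
      rintro rfl
      simp at hθ1
  obtain ⟨δ', hδ'pos, -, hδ'V⟩ := exists_shell_subset_of_isOpen hVopen hSV
  have hne : ∀ y : E4, |‖y‖ - 1| < min δ₀ δ' → Φt y ≠ 0 := fun y hy =>
    (hδ'V y (lt_of_lt_of_le hy (min_le_right _ _))).2
  -- conclusion
  refine ⟨κ, min δ₀ δ', lt_min hδ₀pos hδ'pos, ?_, ?_, ?_, ?_, ?_, ?_, ?_⟩
  · linarith [min_le_left δ₀ δ']
  · calc μ * min δ₀ δ' ≤ μ * δ₀ := by gcongr; exact min_le_left _ _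
      _ ≤ δ₁ := hδ₀μ
  · calc μ * (1 + min δ₀ δ') ≤ μ * (1 + δ₀) := by gcongr; exact min_le_left _ _
      _ < μ' := hδ₀μ'
  · intro y hy
    have hy₀ : |‖y‖ - 1| < δ₀ := lt_of_lt_of_le hy (min_le_left _ _)
    have hMinv := contDiffAt_radMinv hu (hne y hy)
    refine ⟨hMinv.comp y (hΦt_smooth y hy₀), ?_⟩
    have hcomp : κ = (fun w : E4 => Real.exp (-(u (‖w‖⁻¹ • w) / 2)) • w) ∘ Φt := rfl
    rw [hcomp, fderiv_comp y (hMinv.differentiableAt (by simp)) (hΦt_deriv y hy₀).1]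
    intro v w hvw
    exact (hΦt_deriv y hy₀).2 (injective_fderiv_radMinv hu (hne y hy) hvw)
  · intro θ hθ
    show Real.exp (-(u (‖Φt θ‖⁻¹ • Φt θ) / 2)) • Φt θ = θ
    rw [hΦt_sphere θ hθ]
    exact radMinv_model_of_norm_eq_one u hθ
  · intro y hy
    exact hsides y (lt_of_lt_of_le hy (min_le_left _ _))
  · intro x hx
    have hxs : x ∈ ch.source := (mem_chartAt_punctured_source hq).2 hx
    have haffx : aff (A.symm (μ⁻¹ • (e x.1 - c))) = e x.1 := by
      simp only [haff]
      rw [A.apply_symm_apply, smul_smul, mul_inv_cancel₀ hμ.ne', one_smul]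
      abel
    have hchx : ch.symm (e x.1) = x := by
      rw [← chartAt_punctured_apply hq x]
      exact ch.left_inv hxs
    have hΦx : Φt (A.symm (μ⁻¹ • (e x.1 - c))) = Ψ x := by
      show Ψ (ch.symm (aff (A.symm (μ⁻¹ • (e x.1 - c))))) = Ψ x
      rw [haffx, hchx]
    show Real.exp (u (‖κ (A.symm (μ⁻¹ • (e x.1 - c)))‖⁻¹ • κ (A.symm (μ⁻¹ • (e x.1 - c)))) / 2) •
        κ (A.symm (μ⁻¹ • (e x.1 - c))) = Ψ x
    have hκx : κ (A.symm (μ⁻¹ • (e x.1 - c))) =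
        Real.exp (-(u (‖Ψ x‖⁻¹ • Ψ x) / 2)) • Ψ x := by
      show Real.exp (-(u (‖Φt (A.symm (μ⁻¹ • (e x.1 - c)))‖⁻¹ •
          Φt (A.symm (μ⁻¹ • (e x.1 - c)))) / 2)) • Φt (A.symm (μ⁻¹ • (e x.1 - c))) = _
      rw [hΦx]
    rw [hκx]
    exact radM_radMinv u (Ψ x)

end CollarMap

end Summit.SmoothPoincare4.SmoothPoincare4.Theorems.Target.KaehlerJacket

end
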